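import Summits.Ventures.CertifiedManyBodySolver.Upper.UMPSCellBlocking
import Summits.Ventures.CertifiedManyBodySolver.Upper.UMPSBondBookkeeping

/-!
# uMPS upper bound for the Hubbard chain, IV: the cell bond operator `hh` and the blocked chain

HONEST FRAMING: first certified bounds; not a superconductivity verdict; every number certified or
labelled float.

Venture `Ventures/CertifiedManyBodySolver` (sr-mbsolver). VAR's uMPS certificates of record
(`FORMAT-umps1.md`, `ncell = 2`) bound the half-filled Hubbard chain by a uniform MPS on TWO-SITE
CELLS (physical dimension `16`) with the cell bond matrix `hh = g ⊗ 1₁₆ + 1₄ ⊗ g ⊗ 1₄`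
(`g = bondMatrix t U` of `Upper/UMPSBondBookkeeping.lean`). This file writes `hh` and the blocked open
chain in the tree's vocabulary (blocking: `Upper/UMPSCellBlocking.lean`):

* `hopWord σ`, `interWord σ` — the spin-`σ` hopping words of an intra-cell bond (on `ℂ⁴ ⊗ ℂ⁴`) and of
  an inter-cell bond (on `ℂ¹⁶ ⊗ ℂ¹⁶`: right site of the left cell, left site of the right cell);
  `hopMatrix t = -t Σ_σ hopWord σ`, `interHopMatrix t = -t Σ_σ interWord σ`;
* `cellBondMatrix t U` — VAR's `hh`: the intra-cell bond `g` of the LEFT cell (`cellOp g ⊗ 1`) plus the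
  inter-cell bond `g` (`interHopMatrix t` and the on-site terms `U n↑n↓ + (U/2)(1 − n)` of the right
  site of the left cell);
* `posSemidef_smul_one_sub_hopMatrix` / `_add_` — `4|t|·1 ∓ hopMatrix t ⪰ 0`, from the Gram
  identities `(B₀ + ε B₁)ᴴ(B₀ + ε B₁) = 1 ⊗ n_σ + n_σ ⊗ 1 + ε w_σ` (`ε = ±1`, `B₀ = 1 ⊗ c_σ`,
  `B₁ = (F c_σ) ⊗ 1`, using `c†c = n`, `F² = 1`, `Fᴴ = F`) and `1 − n_σ ⪰ 0`;
* `blockOp_toSpin_hamiltonian_pathGraph`, `blockOp_toSpin_totalNumber`, `bondSum_cellBondMatrix` — the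
  open chain of `(n+2)·2` sites blocked into `n + 2` cells:
  `blockOp (toSpin H) = Σ_m (cellOp hop)_m + bondSum n (interHop) + U Σ_m ((n↑n↓ ⊗ 1)_m) + U Σ_m ((1 ⊗ n↑n↓)_m)`,
  `blockOp (toSpin N̂) = Σ_m ((n ⊗ 1)_m + (1 ⊗ n)_m)`, and the bond sum of `hh` over the `n + 1` cell bonds.

Part V (`Upper/UMPSCellBookkeeping.lean`) does the bookkeeping (c) and Part VI
(`Upper/UMPSCellEnergyBound.lean`) the assembly `2 e(t,U) ≤ c`.
-/

noncomputable section

open Matrix Finset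
open scoped ComplexOrder BigOperators Kronecker

namespace Summit.Ventures.CertifiedManyBodySolver.Upper

open Literature.MathematicalPhysics.QuantumLattice
open Literature.MathematicalPhysics.QuantumLattice.JordanWigner

/-! ### Kronecker helpers -/

/-- `(A − B) ⊗ C = A ⊗ C − B ⊗ C`. -/
private theorem sub_kronecker₄ {m n : Type*} (A B : Matrix m m ℂ) (C : Matrix n n ℂ) :
    (A - B) ⊗ₖ C = A ⊗ₖ C - B ⊗ₖ C := by
  ext ⟨i, k⟩ ⟨j, l⟩
  simp [Matrix.kroneckerMap_apply, sub_mul]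

/-- `A ⊗ (B − C) = A ⊗ B − A ⊗ C`. -/
private theorem kronecker_sub₄ {m n : Type*} (A : Matrix m m ℂ) (B C : Matrix n n ℂ) :
    A ⊗ₖ (B - C) = A ⊗ₖ B - A ⊗ₖ C := by
  ext ⟨i, k⟩ ⟨j, l⟩
  simp [Matrix.kroneckerMap_apply, mul_sub]

/-! ### Hopping words -/

/-- The spin-`σ` two-site hopping word `w_σ = (c†_σ F) ⊗ c_σ + (F c_σ) ⊗ c†_σ` of a bond
(`hopMatrix t = -t Σ_σ w_σ`). -/
def hopWord (σ : Fin 2) : Matrix (Fin 4 × Fin 4) (Fin 4 × Fin 4) ℂ :=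
  (siteCreation σ * siteParity) ⊗ₖ siteAnnihilation σ +
    (siteParity * siteAnnihilation σ) ⊗ₖ siteCreation σ

/-- `hopMatrix t = -t Σ_σ hopWord σ` (definitional). -/
theorem hopMatrix_eq_smul_sum_hopWord (t : ℝ) : hopMatrix t = -(t : ℂ) • ∑ σ, hopWord σ := rfl

/-- The spin-`σ` hopping word of an INTER-cell bond, as an operator on (cell) ⊗ (cell):
`(1 ⊗ c†_σ F) ⊗ (c_σ ⊗ 1) + (1 ⊗ F c_σ) ⊗ (c†_σ ⊗ 1)` (right site of the left cell, left site of
the right cell; no further string: the two sites are adjacent in the site-major order). -/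
def interWord (σ : Fin 2) : Matrix (Fin 16 × Fin 16) (Fin 16 × Fin 16) ℂ :=
  cellOp ((1 : Matrix (Fin 4) (Fin 4) ℂ) ⊗ₖ (siteCreation σ * siteParity)) ⊗ₖ
      cellOp (siteAnnihilation σ ⊗ₖ (1 : Matrix (Fin 4) (Fin 4) ℂ)) +
    cellOp ((1 : Matrix (Fin 4) (Fin 4) ℂ) ⊗ₖ (siteParity * siteAnnihilation σ)) ⊗ₖ
      cellOp (siteCreation σ ⊗ₖ (1 : Matrix (Fin 4) (Fin 4) ℂ))

/-- The inter-cell hopping matrix `-t Σ_σ interWord σ` (`= 1₄ ⊗ hopMatrix t ⊗ 1₄` read on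
`ℂ¹⁶ ⊗ ℂ¹⁶` through `cellIndex`). -/
def interHopMatrix (t : ℝ) : Matrix (Fin 16 × Fin 16) (Fin 16 × Fin 16) ℂ :=
  -(t : ℂ) • ∑ σ, interWord σ

/-- **VAR's cell bond matrix `hh`** (`FORMAT-umps1.md` §2, `ncell = 2`):
`hh = g ⊗ 1₁₆ + 1₄ ⊗ g ⊗ 1₄`, `g = bondMatrix t U` — the intra-cell bond `g` of the LEFT cell
(`cellOp g ⊗ 1`) plus the inter-cell bond `g` (its hopping part `interHopMatrix t` and its on-site
terms `U n↑n↓ + (U/2)(1 − n)` on the right site of the left cell). -/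
def cellBondMatrix (t U : ℝ) : Matrix (Fin 16 × Fin 16) (Fin 16 × Fin 16) ℂ :=
  cellOp (bondMatrix t U) ⊗ₖ (1 : Matrix (Fin 16) (Fin 16) ℂ) + interHopMatrix t +
    (U : ℂ) • (cellOp ((1 : Matrix (Fin 4) (Fin 4) ℂ) ⊗ₖ siteDouble) ⊗ₖ (1 : Matrix (Fin 16) (Fin 16) ℂ)) +
    ((U / 2 : ℝ) : ℂ) •
      (cellOp ((1 : Matrix (Fin 4) (Fin 4) ℂ) ⊗ₖ (1 - siteTotalNumber)) ⊗ₖ (1 : Matrix (Fin 16) (Fin 16) ℂ))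

/-! ### `4|t|·1 ∓ hop ⪰ 0` -/

/-- `1 − n_σ ⪰ 0` on one site. -/
theorem posSemidef_one_sub_siteNumber (σ : Fin 2) : (1 - siteNumber σ).PosSemidef := by
  have h : (1 - siteNumber σ : Matrix (Fin 4) (Fin 4) ℂ) =
      diagonal fun a => if σ ∈ siteOcc a then 0 else 1 := by
    rw [siteNumber, ← diagonal_one, diagonal_sub]
    congr 1
    funext a
    split_ifs <;> simp
  rw [h]
  refine posSemidef_diagonal_iff.2 fun a => ?_
  split_ifs <;> simp

/-- The Gram identities `(B₀ ± B₁)ᴴ (B₀ ± B₁) = 1 ⊗ n_σ + n_σ ⊗ 1 ± w_σ` with `B₀ = 1 ⊗ c_σ`,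
`B₁ = (F c_σ) ⊗ 1` (using `c†c = n`, `F² = 1`, `Fᴴ = F`). -/
theorem gram_hopWord (σ : Fin 2) (ε : ℂ) (hε : ε * ε = 1) (hε' : star ε = ε) :
    (((1 : Matrix (Fin 4) (Fin 4) ℂ) ⊗ₖ siteAnnihilation σ) +
          ε • ((siteParity * siteAnnihilation σ) ⊗ₖ (1 : Matrix (Fin 4) (Fin 4) ℂ)))ᴴ *
        (((1 : Matrix (Fin 4) (Fin 4) ℂ) ⊗ₖ siteAnnihilation σ) +
          ε • ((siteParity * siteAnnihilation σ) ⊗ₖ (1 : Matrix (Fin 4) (Fin 4) ℂ))) =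
      (1 : Matrix (Fin 4) (Fin 4) ℂ) ⊗ₖ siteNumber σ + siteNumber σ ⊗ₖ (1 : Matrix (Fin 4) (Fin 4) ℂ) +
        ε • hopWord σ := by
  have hc : (siteAnnihilation σ)ᴴ = siteCreation σ := rfl
  have h1 : ((siteParity * siteAnnihilation σ) ⊗ₖ (1 : Matrix (Fin 4) (Fin 4) ℂ))ᴴ =
      (siteCreation σ * siteParity) ⊗ₖ (1 : Matrix (Fin 4) (Fin 4) ℂ) := by
    rw [conjTranspose_kronecker, conjTranspose_mul, conjTranspose_one, siteParity_conjTranspose, hc]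
  have h0 : (((1 : Matrix (Fin 4) (Fin 4) ℂ) ⊗ₖ siteAnnihilation σ))ᴴ =
      (1 : Matrix (Fin 4) (Fin 4) ℂ) ⊗ₖ siteCreation σ := by
    rw [conjTranspose_kronecker, conjTranspose_one, hc]
  have hFF : siteCreation σ * siteParity * (siteParity * siteAnnihilation σ) = siteNumber σ := by
    rw [Matrix.mul_assoc, ← Matrix.mul_assoc siteParity, siteParity_mul_siteParity, Matrix.one_mul,
      siteCreation_mul_siteAnnihilation]
  rw [conjTranspose_add, conjTranspose_smul, h0, h1, hε', add_mul, mul_add, mul_add, smul_mul_assoc,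
    smul_mul_assoc, mul_smul_comm, mul_smul_comm, smul_smul, hε, one_smul, ← mul_kronecker_mul,
    ← mul_kronecker_mul, ← mul_kronecker_mul, ← mul_kronecker_mul, Matrix.one_mul, Matrix.mul_one,
    Matrix.mul_one, Matrix.one_mul, Matrix.one_mul, siteCreation_mul_siteAnnihilation, hFF, hopWord,
    smul_add]
  abel

/-- `2·1 + ε w_σ ⪰ 0` for `ε = ±1`:
`2·1 + ε w_σ = (B₀ + ε B₁)ᴴ(B₀ + ε B₁) + (1 − n_σ) ⊗ 1 + 1 ⊗ (1 − n_σ)`. -/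
theorem posSemidef_two_smul_one_add_smul_hopWord (σ : Fin 2) (ε : ℂ) (hε : ε * ε = 1)
    (hε' : star ε = ε) :
    ((2 : ℂ) • (1 : Matrix (Fin 4 × Fin 4) (Fin 4 × Fin 4) ℂ) + ε • hopWord σ).PosSemidef := by
  have h : (2 : ℂ) • (1 : Matrix (Fin 4 × Fin 4) (Fin 4 × Fin 4) ℂ) + ε • hopWord σ =
      (((1 : Matrix (Fin 4) (Fin 4) ℂ) ⊗ₖ siteAnnihilation σ) +
            ε • ((siteParity * siteAnnihilation σ) ⊗ₖ (1 : Matrix (Fin 4) (Fin 4) ℂ)))ᴴ *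
          (((1 : Matrix (Fin 4) (Fin 4) ℂ) ⊗ₖ siteAnnihilation σ) +
            ε • ((siteParity * siteAnnihilation σ) ⊗ₖ (1 : Matrix (Fin 4) (Fin 4) ℂ))) +
        (((1 - siteNumber σ) ⊗ₖ (1 : Matrix (Fin 4) (Fin 4) ℂ)) +
          ((1 : Matrix (Fin 4) (Fin 4) ℂ) ⊗ₖ (1 - siteNumber σ))) := by
    rw [gram_hopWord σ ε hε hε', sub_kronecker₄, kronecker_sub₄, one_kronecker_one, two_smul]
    abel
  rw [h]
  exact (posSemidef_conjTranspose_mul_self _).add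
    (((posSemidef_one_sub_siteNumber σ).kronecker Matrix.PosSemidef.one).add
      (Matrix.PosSemidef.one.kronecker (posSemidef_one_sub_siteNumber σ)))

/-- **`4|t|·1 − hopMatrix t ⪰ 0`** (the two-site hopping energy is at least `-4|t|`). -/
theorem posSemidef_smul_one_sub_hopMatrix (t : ℝ) :
    (((4 * |t| : ℝ) : ℂ) • (1 : Matrix (Fin 4 × Fin 4) (Fin 4 × Fin 4) ℂ) - hopMatrix t).PosSemidef := by
  rcases le_total 0 t with ht | ht
  · have hp := fun σ => posSemidef_two_smul_one_add_smul_hopWord σ 1 (by norm_num) (by simp)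
    have h : ((4 * |t| : ℝ) : ℂ) • (1 : Matrix (Fin 4 × Fin 4) (Fin 4 × Fin 4) ℂ) - hopMatrix t =
        (t : ℂ) • (((2 : ℂ) • 1 + (1 : ℂ) • hopWord 0) + ((2 : ℂ) • 1 + (1 : ℂ) • hopWord 1)) := by
      rw [abs_of_nonneg ht, hopMatrix_eq_smul_sum_hopWord, Fin.sum_univ_two]
      push_cast
      module
    rw [h]
    exact ((hp 0).add (hp 1)).smul (Complex.zero_le_real.2 ht)
  · have hp := fun σ => posSemidef_two_smul_one_add_smul_hopWord σ (-1) (by norm_num) (by simp)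
    have h : ((4 * |t| : ℝ) : ℂ) • (1 : Matrix (Fin 4 × Fin 4) (Fin 4 × Fin 4) ℂ) - hopMatrix t =
        ((-t : ℝ) : ℂ) • (((2 : ℂ) • 1 + (-1 : ℂ) • hopWord 0) + ((2 : ℂ) • 1 + (-1 : ℂ) • hopWord 1)) := by
      rw [abs_of_nonpos ht, hopMatrix_eq_smul_sum_hopWord, Fin.sum_univ_two]
      push_cast
      module
    rw [h]
    exact ((hp 0).add (hp 1)).smul (Complex.zero_le_real.2 (by linarith))

/-- **`4|t|·1 + hopMatrix t ⪰ 0`** (the two-site hopping energy is at most `4|t|`). -/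
theorem posSemidef_smul_one_add_hopMatrix (t : ℝ) :
    (((4 * |t| : ℝ) : ℂ) • (1 : Matrix (Fin 4 × Fin 4) (Fin 4 × Fin 4) ℂ) + hopMatrix t).PosSemidef := by
  rcases le_total 0 t with ht | ht
  · have hp := fun σ => posSemidef_two_smul_one_add_smul_hopWord σ (-1) (by norm_num) (by simp)
    have h : ((4 * |t| : ℝ) : ℂ) • (1 : Matrix (Fin 4 × Fin 4) (Fin 4 × Fin 4) ℂ) + hopMatrix t =
        (t : ℂ) • (((2 : ℂ) • 1 + (-1 : ℂ) • hopWord 0) + ((2 : ℂ) • 1 + (-1 : ℂ) • hopWord 1)) := by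
      rw [abs_of_nonneg ht, hopMatrix_eq_smul_sum_hopWord, Fin.sum_univ_two]
      push_cast
      module
    rw [h]
    exact ((hp 0).add (hp 1)).smul (Complex.zero_le_real.2 ht)
  · have hp := fun σ => posSemidef_two_smul_one_add_smul_hopWord σ 1 (by norm_num) (by simp)
    have h : ((4 * |t| : ℝ) : ℂ) • (1 : Matrix (Fin 4 × Fin 4) (Fin 4 × Fin 4) ℂ) + hopMatrix t =
        ((-t : ℝ) : ℂ) • (((2 : ℂ) • 1 + (1 : ℂ) • hopWord 0) + ((2 : ℂ) • 1 + (1 : ℂ) • hopWord 1)) := by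
      rw [abs_of_nonpos ht, hopMatrix_eq_smul_sum_hopWord, Fin.sum_univ_two]
      push_cast
      module
    rw [h]
    exact ((hp 0).add (hp 1)).smul (Complex.zero_le_real.2 (by linarith))

/-! ### The blocked chain -/

/-- The intra-cell hopping words of cell `m` block to `onSite m (cellOp (Σ_σ hopWord σ))`. -/
theorem blockOp_intraHop (n : ℕ) (m : Fin (n + 2)) :
    blockOp (n + 2) (∑ σ : Fin 2,
        (onSite (site (n + 2) m 0) (siteCreation σ * siteParity) *
            onSite (site (n + 2) m 1) (siteAnnihilation σ) +
          onSite (site (n + 2) m 0) (siteParity * siteAnnihilation σ) *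
            onSite (site (n + 2) m 1) (siteCreation σ))) =
      onSite m (cellOp (∑ σ, hopWord σ)) := by
  simp only [Fin.sum_univ_two, map_add, blockOp_intra, hopWord, onSite_add', add_assoc]

/-- The inter-cell hopping words of the bond `(x, x+1)` block to `twoSiteOp x (Σ_σ interWord σ)`. -/
theorem blockOp_interHop (n : ℕ) (x : Fin (n + 1)) :
    blockOp (n + 2) (∑ σ : Fin 2,
        (onSite (site (n + 2) ⟨x, by omega⟩ 1) (siteCreation σ * siteParity) *
            onSite (site (n + 2) ⟨x + 1, by omega⟩ 0) (siteAnnihilation σ) +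
          onSite (site (n + 2) ⟨x, by omega⟩ 1) (siteParity * siteAnnihilation σ) *
            onSite (site (n + 2) ⟨x + 1, by omega⟩ 0) (siteCreation σ))) =
      twoSiteOp (n + 2) x (by omega) (∑ σ, interWord σ) := by
  simp only [Fin.sum_univ_two, map_add, blockOp_inter, interWord, twoSiteOp_add, add_assoc]

/-- **The open chain of `(n+2)·2` sites, blocked into `n + 2` cells**:
`blockOp (toSpin H) = Σ_m (cellOp hop)_m + bondSum n (interHop) + (U Σ_m (n↑n↓ ⊗ 1)_m + U Σ_m (1 ⊗ n↑n↓)_m)`. -/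
theorem blockOp_toSpin_hamiltonian_pathGraph (n : ℕ) (t U : ℝ) :
    blockOp (n + 2) (toSpin (hamiltonian (SimpleGraph.pathGraph ((n + 2) * 2)) t U)) =
      ∑ m : Fin (n + 2), onSite m (cellOp (hopMatrix t)) + bondSum n (interHopMatrix t) +
        ((U : ℂ) • ∑ m : Fin (n + 2), onSite m (cellOp (siteDouble ⊗ₖ (1 : Matrix (Fin 4) (Fin 4) ℂ))) +
          (U : ℂ) • ∑ m : Fin (n + 2), onSite m (cellOp ((1 : Matrix (Fin 4) (Fin 4) ℂ) ⊗ₖ siteDouble))) := by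
  have hI : (∑ m : Fin (n + 2), onSite m (cellOp (hopMatrix t)) : Op (Fin (n + 2)) 16) =
      -(t : ℂ) • ∑ m : Fin (n + 2), onSite m (cellOp (∑ σ, hopWord σ)) := by
    rw [Finset.smul_sum]
    refine Finset.sum_congr rfl fun m _ => ?_
    rw [hopMatrix_eq_smul_sum_hopWord, map_smul, onSite_smul']
  have hB : (bondSum n (interHopMatrix t) : Op (Fin (n + 2)) 16) =
      -(t : ℂ) • ∑ x : Fin (n + 1), twoSiteOp (n + 2) x (by omega) (∑ σ, interWord σ) := by
    rw [bondSum, Finset.smul_sum]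
    refine Finset.sum_congr rfl fun x _ => ?_
    rw [interHopMatrix, twoSiteOp_smul]
  rw [toSpin_hamiltonian_pathGraph, sum_sum_ite_val_succ_sites, map_add, map_smul, map_smul, map_add,
    map_sum, map_sum, map_sum, sum_sites_eq_sum_cells, hI, hB, ← smul_add, ← smul_add,
    ← Finset.sum_add_distrib]
  simp only [blockOp_intraHop, blockOp_interHop, blockOp_onSite_zero, blockOp_onSite_one]

/-- `blockOp (toSpin N̂) = Σ_m ((n ⊗ 1)_m + (1 ⊗ n)_m)`. -/
theorem blockOp_toSpin_totalNumber (n : ℕ) :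
    blockOp (n + 2) (toSpin (totalNumber (Λ := Fin ((n + 2) * 2)))) =
      ∑ m : Fin (n + 2), (onSite m (cellOp (siteTotalNumber ⊗ₖ (1 : Matrix (Fin 4) (Fin 4) ℂ))) +
        onSite m (cellOp ((1 : Matrix (Fin 4) (Fin 4) ℂ) ⊗ₖ siteTotalNumber))) := by
  rw [toSpin_totalNumber, map_sum, sum_sites_eq_sum_cells]
  simp only [blockOp_onSite_zero, blockOp_onSite_one]

/-- **The bond sum of `hh`** over the `n + 1` bonds of the cell chain. -/
theorem bondSum_cellBondMatrix (n : ℕ) (t U : ℝ) :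
    (bondSum n (cellBondMatrix t U) : Op (Fin (n + 2)) 16) =
      ∑ x : Fin (n + 1), onSite (⟨x, by omega⟩ : Fin (n + 2)) (cellOp (bondMatrix t U)) +
        bondSum n (interHopMatrix t) +
        (U : ℂ) • ∑ x : Fin (n + 1), onSite (⟨x, by omega⟩ : Fin (n + 2))
          (cellOp ((1 : Matrix (Fin 4) (Fin 4) ℂ) ⊗ₖ siteDouble)) +
        ((U / 2 : ℝ) : ℂ) • ∑ x : Fin (n + 1), onSite (⟨x, by omega⟩ : Fin (n + 2))
          (cellOp ((1 : Matrix (Fin 4) (Fin 4) ℂ) ⊗ₖ (1 - siteTotalNumber))) := by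
  rw [cellBondMatrix, bondSum_add, bondSum_add, bondSum_add, bondSum_smul, bondSum_smul,
    bondSum_kronecker, bondSum_kronecker, bondSum_kronecker]
  simp only [onSite_one', mul_one]

/-- `(cellOp g)_x = (cellOp hop)_x + U (cellOp (n↑n↓ ⊗ 1))_x + (U/2) (cellOp ((1 − n) ⊗ 1))_x`. -/
theorem onSite_cellOp_bondMatrix {C : ℕ} (x : Fin C) (t U : ℝ) :
    (onSite x (cellOp (bondMatrix t U)) : Op (Fin C) 16) =
      onSite x (cellOp (hopMatrix t)) +
        (U : ℂ) • onSite x (cellOp (siteDouble ⊗ₖ (1 : Matrix (Fin 4) (Fin 4) ℂ))) +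
        ((U / 2 : ℝ) : ℂ) • onSite x (cellOp ((1 - siteTotalNumber) ⊗ₖ (1 : Matrix (Fin 4) (Fin 4) ℂ))) := by
  rw [bondMatrix, map_add, map_add, map_smul, map_smul, onSite_add', onSite_add', onSite_smul',
    onSite_smul']

/-! ### Positivity of the cell one-site matrices -/

/-- `cellOp (M ⊗ 1) ⪰ 0` for `M ⪰ 0`. -/
theorem posSemidef_cellOp_kronecker_one {M : Matrix (Fin 4) (Fin 4) ℂ} (hM : M.PosSemidef) :
    (cellOp (M ⊗ₖ (1 : Matrix (Fin 4) (Fin 4) ℂ))).PosSemidef :=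
  (posSemidef_cellOp_iff _).2 (hM.kronecker Matrix.PosSemidef.one)

/-- `cellOp (1 ⊗ M) ⪰ 0` for `M ⪰ 0`. -/
theorem posSemidef_cellOp_one_kronecker {M : Matrix (Fin 4) (Fin 4) ℂ} (hM : M.PosSemidef) :
    (cellOp ((1 : Matrix (Fin 4) (Fin 4) ℂ) ⊗ₖ M)).PosSemidef :=
  (posSemidef_cellOp_iff _).2 (Matrix.PosSemidef.one.kronecker hM)

/-- `1 − cellOp (M ⊗ 1) = cellOp ((1 − M) ⊗ 1)`. -/
theorem one_sub_cellOp_kronecker_one (M : Matrix (Fin 4) (Fin 4) ℂ) :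
    1 - cellOp (M ⊗ₖ (1 : Matrix (Fin 4) (Fin 4) ℂ)) = cellOp ((1 - M) ⊗ₖ (1 : Matrix (Fin 4) (Fin 4) ℂ)) := by
  rw [sub_kronecker₄, one_kronecker_one, map_sub, map_one]

/-- `1 − cellOp (1 ⊗ M) = cellOp (1 ⊗ (1 − M))`. -/
theorem one_sub_cellOp_one_kronecker (M : Matrix (Fin 4) (Fin 4) ℂ) :
    1 - cellOp ((1 : Matrix (Fin 4) (Fin 4) ℂ) ⊗ₖ M) = cellOp ((1 : Matrix (Fin 4) (Fin 4) ℂ) ⊗ₖ (1 - M)) := by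
  rw [kronecker_sub₄, one_kronecker_one, map_sub, map_one]

/-- `b·1 − cellOp (M ⊗ 1) = cellOp ((b·1 − M) ⊗ 1)`. -/
theorem smul_one_sub_cellOp_kronecker_one (b : ℂ) (M : Matrix (Fin 4 × Fin 4) (Fin 4 × Fin 4) ℂ) :
    b • 1 - cellOp M = cellOp (b • 1 - M) := by
  rw [map_sub, map_smul, map_one]

end Summit.Ventures.CertifiedManyBodySolver.Upper

end
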